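import Summits.HodgeConjecture.HodgeCM.Automorphic.WeilThetaModelHeisenbergPs_1

/-! PORT of `HodgeCM/Automorphic/WeilThetaModelHeisenbergPs.lean` (HodgeCMPerL run 82) — part 2: continuation of `Summits.HodgeConjecture.HodgeCM.Automorphic.WeilThetaModelHeisenbergPs_1` (split at a top-level declaration boundary by port_pkg.py; scope re-opened below; declarations unchanged). -/

-- port_pkg: scope re-opened for this part (file-level context, then the namespace/section stack open at the cut)
set_option autoImplicit false
noncomputable section
open Topology MeasureTheory
open scoped RealInnerProductSpace FourierTransform SchwartzMap
namespace HodgeCM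
namespace SchwartzWeil
section SelfDual
variable (V : Type) [NormedAddCommGroup V] [InnerProductSpace ℝ V] [FiniteDimensional ℝ V] [MeasurableSpace V]
  [BorelSpace V] (L : Submodule ℤ V) [DiscreteTopology L] [IsZLattice ℝ L] (m : ℤ)
/-- **The Weil theta model on `Heis V ⋊ F⟨σ,u⟩` for a self-dual lattice**: prl1-g4's
`WeilThetaModel (HeisP V m) ⟨arith, σ, u⟩ U(1) Γ` with every field a theorem; `σ` acts by `𝓕`, `u` by `T_m`. -/
def heisenbergPsModel (hm : m ≠ 0) (hL : PoissonSummation.dualLattice L = L) (Γ : Subgroup Circle)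
    (hΓ : ∀ u ∈ Γ, u ^ m = 1) : HodgeCM.WeilThetaModel (HeisP V m hm) (arithP V L m hm) Circle Γ :=
  heisenbergAdjoinModel V L m (Heis.psAction_center m hm) (intertwines_psRep V m hm) (fixesTheta_psRep V L m hL) Γ hΓ

/-- (Ported verbatim from the HodgeCMPerL package; no docstring in the source.) -/
theorem heisenbergPsModel_def (hm : m ≠ 0) (hL : PoissonSummation.dualLattice L = L) (Γ : Subgroup Circle)
    (hΓ : ∀ u ∈ Γ, u ^ m = 1) :
    heisenbergPsModel V L m hm hL Γ hΓ =
      heisenbergAdjoinModel V L m (Heis.psAction_center m hm) (intertwines_psRep V m hm)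
        (fixesTheta_psRep V L m hL) Γ hΓ := rfl

/-- (Ported verbatim from the HodgeCMPerL package; no docstring in the source.) -/
@[simp] theorem heisenbergPsModel_SK (hm : m ≠ 0) (hL : PoissonSummation.dualLattice L = L) (Γ : Subgroup Circle)
    (hΓ : ∀ u ∈ Γ, u ^ m = 1) : (heisenbergPsModel V L m hm hL Γ hΓ).SK = Set.univ := rfl

/-- The action of the model is `ρ̃ = repP`. -/
theorem heisenbergPsModel_act (hm : m ≠ 0) (hL : PoissonSummation.dualLattice L = L) (Γ : Subgroup Circle)
    (hΓ : ∀ u ∈ Γ, u ^ m = 1) (x : HeisP V m hm) (Φ : 𝓢(V, ℂ)) :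
    (heisenbergPsModel V L m hm hL Γ hΓ).W.act x Φ = (repP V m hm x : 𝓢(V, ℂ) →L[ℂ] 𝓢(V, ℂ)) Φ := rfl

/-- **Consistency with #5** on the Heisenberg group. -/
theorem heisenbergPsModel_θ_mk_inl (hm : m ≠ 0) (hL : PoissonSummation.dualLattice L = L) (Γ : Subgroup Circle)
    (hΓ : ∀ u ∈ Γ, u ^ m = 1) (Φ : 𝓢(V, ℂ)) (h : Heis V) (z : Circle) :
    (heisenbergPsModel V L m hm hL Γ hΓ).θ ⟨Φ, Set.mem_univ Φ⟩
        (QuotientGroup.mk (SemidirectProduct.inl h), QuotientGroup.mk z) =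
      (heisenbergModel V L m Γ hΓ).θ ⟨Φ, Set.mem_univ Φ⟩ (QuotientGroup.mk h, QuotientGroup.mk z) :=
  heisenbergAdjoinModel_θ_mk_inl V L m _ _ _ Γ hΓ Φ h z

/-- **`σ` is absorbed by the kernel.** -/
theorem heisenbergPsModel_θ_weyl_mul (hm : m ≠ 0) (hL : PoissonSummation.dualLattice L = L) (Γ : Subgroup Circle)
    (hΓ : ∀ u ∈ Γ, u ^ m = 1) (Φ : (heisenbergPsModel V L m hm hL Γ hΓ).SK) (x : HeisP V m hm) (q : Circle ⧸ Γ) :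
    (heisenbergPsModel V L m hm hL Γ hΓ).θ Φ
        (QuotientGroup.mk (x * SemidirectProduct.inr (FreeGroup.of PsGen.weyl)), q) =
      (heisenbergPsModel V L m hm hL Γ hΓ).θ Φ (QuotientGroup.mk x, q) :=
  heisenbergAdjoinModel_θ_inr_mul V L m _ _ _ Γ hΓ Φ x _ q

/-- **`u` is absorbed by the kernel.** -/
theorem heisenbergPsModel_θ_unip_mul (hm : m ≠ 0) (hL : PoissonSummation.dualLattice L = L) (Γ : Subgroup Circle)
    (hΓ : ∀ u ∈ Γ, u ^ m = 1) (Φ : (heisenbergPsModel V L m hm hL Γ hΓ).SK) (x : HeisP V m hm) (q : Circle ⧸ Γ) :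
    (heisenbergPsModel V L m hm hL Γ hΓ).θ Φ
        (QuotientGroup.mk (x * SemidirectProduct.inr (FreeGroup.of PsGen.unip)), q) =
      (heisenbergPsModel V L m hm hL Γ hΓ).θ Φ (QuotientGroup.mk x, q) :=
  heisenbergAdjoinModel_θ_inr_mul V L m _ _ _ Γ hΓ Φ x _ q

/-- Every element of `F⟨σ,u⟩` is absorbed by the kernel. -/
theorem heisenbergPsModel_θ_inr_mul (hm : m ≠ 0) (hL : PoissonSummation.dualLattice L = L) (Γ : Subgroup Circle)
    (hΓ : ∀ u ∈ Γ, u ^ m = 1) (Φ : (heisenbergPsModel V L m hm hL Γ hΓ).SK) (x : HeisP V m hm)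
    (g : FreeGroup PsGen) (q : Circle ⧸ Γ) :
    (heisenbergPsModel V L m hm hL Γ hΓ).θ Φ (QuotientGroup.mk (x * SemidirectProduct.inr g), q) =
      (heisenbergPsModel V L m hm hL Γ hΓ).θ Φ (QuotientGroup.mk x, q) :=
  heisenbergAdjoinModel_θ_inr_mul V L m _ _ _ Γ hΓ Φ x g q

/-- Non-degeneracy. -/
theorem heisenbergPsModel_θ_ne_zero (hm : m ≠ 0) (hL : PoissonSummation.dualLattice L = L) (Γ : Subgroup Circle)
    (hΓ : ∀ u ∈ Γ, u ^ m = 1) :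
    ∃ Φ : (heisenbergPsModel V L m hm hL Γ hΓ).SK,
      (heisenbergPsModel V L m hm hL Γ hΓ).θ Φ (QuotientGroup.mk 1, QuotientGroup.mk 1) ≠ 0 :=
  heisenbergAdjoinModel_θ_ne_zero V L m _ _ _ Γ hΓ

/-- The three structural laws of prl1-g4's record. -/
theorem heisenbergPsModel_structural_laws (hm : m ≠ 0) (hL : PoissonSummation.dualLattice L = L)
    (Γ : Subgroup Circle) (hΓ : ∀ u ∈ Γ, u ^ m = 1) :
    (∀ Φ : (heisenbergPsModel V L m hm hL Γ hΓ).SK, (heisenbergPsModel V L m hm hL Γ hΓ).omg 1 Φ = Φ) ∧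
      Continuous (heisenbergPsModel V L m hm hL Γ hΓ).θ ∧
      ∀ (z : Circle) (Φ : (heisenbergPsModel V L m hm hL Γ hΓ).SK) (ξ : HeisP V m hm ⧸ arithP V L m hm)
        (q : Circle ⧸ Γ),
        (heisenbergPsModel V L m hm hL Γ hΓ).θ ((heisenbergPsModel V L m hm hL Γ hΓ).omg z Φ) (ξ, q) =
          (heisenbergPsModel V L m hm hL Γ hΓ).θ Φ (ξ, z⁻¹ • q) :=
  (heisenbergPsModel V L m hm hL Γ hΓ).structural_laws

end SelfDual

/-! ## 6. The lattice junction -/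

section Lattice

variable (V : Type) [NormedAddCommGroup V] [InnerProductSpace ℝ V] [FiniteDimensional ℝ V] (L : Submodule ℤ V)
  [DiscreteTopology L] [IsZLattice ℝ L] (m : ℤ) [NeZero m]

/-- **`(Heis V ⋊ F⟨σ,u⟩, ⟨arith, σ, u⟩)` is a cocompact lattice model** for a self-dual lattice. -/
def heisenbergPsLatticeModel (hL : PoissonSummation.dualLattice L = L) : CocompactLatticeModel :=
  heisenbergAdjoinLatticeModel V L m (Heis.continuous_psAction m (NeZero.ne m))
    (preservesArith_psAction V L m hL (NeZero.ne m))

/-- (Ported verbatim from the HodgeCMPerL package; no docstring in the source.) -/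
@[simp] theorem heisenbergPsLatticeModel_G (hL : PoissonSummation.dualLattice L = L) :
    (heisenbergPsLatticeModel V L m hL).G = HeisP V m (NeZero.ne m) := rfl

/-- (Ported verbatim from the HodgeCMPerL package; no docstring in the source.) -/
@[simp] theorem heisenbergPsLatticeModel_Γ (hL : PoissonSummation.dualLattice L = L) :
    (heisenbergPsLatticeModel V L m hL).Γ = arithP V L m (NeZero.ne m) := rfl

/-- `arithP` is discrete. -/
theorem discreteTopology_arithP (hL : PoissonSummation.dualLattice L = L) :
    DiscreteTopology (arithP V L m (NeZero.ne m)) :=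
  discreteTopology_arithSD V L m (preservesArith_psAction V L m hL (NeZero.ne m))

/-- `HeisP V m ⧸ arithP` is compact. -/
theorem compactSpace_quotient_arithP : CompactSpace (HeisP V m (NeZero.ne m) ⧸ arithP V L m (NeZero.ne m)) :=
  inferInstance

variable [MeasurableSpace V] [BorelSpace V]

/-- The model of §5 over the carriers of the lattice model. -/
def heisenbergPsModelOverLattice (hL : PoissonSummation.dualLattice L = L) (Γ : Subgroup Circle) [Finite Γ]
    (hΓ : ∀ u ∈ Γ, u ^ m = 1) :
    HodgeCM.WeilThetaModel (heisenbergPsLatticeModel V L m hL).toQuotientModel.G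
      (heisenbergPsLatticeModel V L m hL).toQuotientModel.Γ (circleLatticeModel Γ).toQuotientModel.G
      (circleLatticeModel Γ).toQuotientModel.Γ :=
  heisenbergPsModel V L m (NeZero.ne m) hL Γ hΓ

/-- (Ported verbatim from the HodgeCMPerL package; no docstring in the source.) -/
theorem heisenbergPsModelOverLattice_θ_ne_zero (hL : PoissonSummation.dualLattice L = L) (Γ : Subgroup Circle)
    [Finite Γ] (hΓ : ∀ u ∈ Γ, u ^ m = 1) :
    ∃ Φ, (heisenbergPsModelOverLattice V L m hL Γ hΓ).θ Φ (QuotientGroup.mk 1, QuotientGroup.mk 1) ≠ 0 :=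
  heisenbergPsModel_θ_ne_zero V L m (NeZero.ne m) hL Γ hΓ

end Lattice

/-! ## 7. The standard instances: `V = ℝⁿ`, `L = ℤⁿ` (self-dual), `Γ = 1` -/

section Standard

/-- **The model on `Heis(ℝⁿ) ⋊ F⟨σ,u⟩` over `⟨arith(ℤⁿ, m), σ, u⟩`, `m ≠ 0`.** -/
def heisenbergPsModelStd (n : ℕ) (m : ℤ) [NeZero m] :
    HodgeCM.WeilThetaModel (HeisP (EuclideanSpace ℝ (Fin n)) m (NeZero.ne m))
      (arithP (EuclideanSpace ℝ (Fin n)) (Submodule.span ℤ (Set.range (PiLp.basisFun 2 ℝ (Fin n)))) m (NeZero.ne m))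
      Circle (⊥ : Subgroup Circle) :=
  heisenbergPsModel (EuclideanSpace ℝ (Fin n)) (Submodule.span ℤ (Set.range (PiLp.basisFun 2 ℝ (Fin n)))) m
    (NeZero.ne m) (SelfDual.dualLattice_zn n) ⊥ fun u hu => by rw [Subgroup.mem_bot.mp hu, one_zpow]

/-- (Ported verbatim from the HodgeCMPerL package; no docstring in the source.) -/
theorem heisenbergPsModelStd_θ_ne_zero (n : ℕ) (m : ℤ) [NeZero m] :
    ∃ Φ, (heisenbergPsModelStd n m).θ Φ (QuotientGroup.mk 1, QuotientGroup.mk 1) ≠ 0 :=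
  heisenbergPsModel_θ_ne_zero _ _ m (NeZero.ne m) _ ⊥ _

/-- **The cocompact lattice model `(Heis(ℝⁿ) ⋊ F⟨σ,u⟩, ⟨arith(ℤⁿ, m), σ, u⟩)`.** -/
def heisenbergPsLatticeModelStd (n : ℕ) (m : ℤ) [NeZero m] : CocompactLatticeModel :=
  heisenbergPsLatticeModel (EuclideanSpace ℝ (Fin n)) (Submodule.span ℤ (Set.range (PiLp.basisFun 2 ℝ (Fin n)))) m
    (SelfDual.dualLattice_zn n)

end Standard

end SchwartzWeil
end HodgeCM

-- port_pkg: scope closed for this part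
end
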